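import Mathlib
import Literature.MathematicalPhysics.QuantumManyBody.GroundStateFeynmanKacSpectral
import Summits.RiemannHypothesis.RiemannHypothesis.Theorems.SuzukiWindowsDoorOpPath

/-!
# Temple's inequality for compact symmetric operators and Suzuki's window operator `𝖪[t]` (RH-free, K-general)

Kernel-checked LOGIC of the sharp («Temple-route») enclosures of the rh-dbr data column ET1e (DATA.md §ET1e,
rh-dbr-eng-3 g3): companion of `SuzukiWindowsDoorGalerkinWindow` / `…GalerkinBessel` / `…GalerkinMonotone`
(p437286 / p438128 / p439269 = the Weyl-route logic `‖𝖪[t]‖ ≤ μ₀ + δ`).  For the small-θ kernels `K_θ`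
(derivative jump of order `θ − 1` across the anti-diagonal) the Hilbert–Schmidt projection remainder `δ` is
only `1e-3 … 1e-5`, and Temple's inequality squares it.

Abstract layer (real inner product space `E`, `T` symmetric):
* `eigenvalue_le_temple`: `T e = β e`, `‖e‖ = 1`, `⟪T w, w⟫ ≤ a‖w‖²` on `e^⊥`, unit `u` with `η = ⟪T u, u⟫ > a`
  ⟹ `β ≤ η + (‖T u‖² − η²)/(η − a)` — pure algebra of the decomposition `u = ⟪u,e⟫e + w`, no spectral theorem;
* `inner_le_temple_mul_norm_sq`: hence `⟪T f, f⟫ ≤ (η + (‖T u‖² − η²)/(η − a)) ‖f‖²` for all `f`;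
* `exists_eigenvector_of_rayleigh_sup`: for `T` COMPACT symmetric on a Hilbert space the top of the form
  `β = sup ⟪T x, x⟫ > 0` is attained at a unit eigenvector (maximising sequence, the positive shift `T + ‖T‖`,
  the tree's `BoseGas.tendsto_sub_smul_of_rayleigh`, compactness);
* `inner_le_of_orthogonal_of_ker`: a form bound `≤ a` on the kernel of ONE linear functional (codimension one —
  what a Galerkin matrix deflated at its top Ritz vector certifies) transfers to `e^⊥` when `a < β`;
* `inner_le_temple_of_isCompactOperator`, `inner_le_temple_certificate`: the assembled bound, in the shape the
  engine's interval data plug into (`η₁ ≤ η ≤ η₂`, `‖T u‖² − η² ≤ r₂`, `a < η₁`, `0 < η₁`).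
Concrete layer: `inner_le_temple_certificate_op` for the tree's window operator
`SuzukiWindowsDoorOpPath.op hK t` (self-adjoint and compact: `isSelfAdjoint_op`, `isCompactOperator_op`).

NOT here: the bridge from the Galerkin matrix `M` of `𝖪[t]` in an orthonormal piecewise-Legendre basis to the
`ker L` premise (`L g = Σᵢ uᵢ⟨g, φᵢ⟩`, `⟪𝖪[t]g, g⟫ ≤ cᵀMc + δ‖g‖² ≤ (max(a₀,0) + δ)‖g‖²` on `ker L`) — that is the
Weyl-route algebra of p439269 and stays engine-side for now; and the mirror statement for `λ_min` (apply to `−T`).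
RH-FREE operator theory; a certified window `‖𝖪_θ[t]‖ < 1` is an RH-consequence check, never evidence for RH;
nothing here bears on the truth of RH.

References: G. Temple, Proc. R. Soc. A 119 (1928); T. Kato, J. Phys. Soc. Japan 4 (1949) 334–339;
M. Reed, B. Simon, Methods of Modern Mathematical Physics IV (1978), Thm XIII.44 (cf. I, Thm VI.16);
M. Suzuki, ASPM 84 (2020) = arXiv:1907.07302, Thm. 1.2 (the operators `𝖪_θ[t]`).
-/

set_option linter.dupNamespace false

namespace Summit.RiemannHypothesis.RiemannHypothesis.Theorems.SuzukiWindowsDoorTemple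

open RealInnerProductSpace Filter Topology
open Literature.MathematicalPhysics.QuantumManyBody.BoseGas (opNorm_le_of_rayleigh_le rayleigh_le_opNorm tendsto_sub_smul_of_rayleigh)

variable {E : Type*} [NormedAddCommGroup E] [InnerProductSpace ℝ E]

/-- **Temple's inequality, algebraic form.** `T` symmetric, `T e = β • e`, `‖e‖ = 1`, `⟪T w, w⟫ ≤ a‖w‖²` for
all `w ⊥ e`, `‖u‖ = 1` and `a < η := ⟪T u, u⟫`; then `β ≤ η + (‖T u‖² − η²)/(η − a)`.
[folklore: Temple 1928; Kato, J. Phys. Soc. Japan 4 (1949)] -/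
theorem eigenvalue_le_temple (T : E →ₗ[ℝ] E) (hsym : ∀ x y : E, ⟪T x, y⟫ = ⟪x, T y⟫)
    {β : ℝ} {e : E} (he : ‖e‖ = 1) (hTe : T e = β • e)
    {a : ℝ} (h2 : ∀ w : E, ⟪w, e⟫ = 0 → ⟪T w, w⟫ ≤ a * ‖w‖ ^ 2)
    {u : E} (hu : ‖u‖ = 1) (ha : a < ⟪T u, u⟫) :
    β ≤ ⟪T u, u⟫ + (‖T u‖ ^ 2 - ⟪T u, u⟫ ^ 2) / (⟪T u, u⟫ - a) := by
  -- decomposition u = α e + w, w ⊥ e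
  set α : ℝ := ⟪u, e⟫ with hα
  set w : E := u - α • e with hw
  have hee : ⟪e, e⟫ = 1 := by
    rw [real_inner_self_eq_norm_sq, he, one_pow]
  have hwe : ⟪w, e⟫ = 0 := by
    rw [hw, inner_sub_left, real_inner_smul_left, hee, mul_one, sub_self]
  have hew : ⟪e, w⟫ = 0 := by rw [real_inner_comm]; exact hwe
  have hu_dec : u = α • e + w := by rw [hw]; abel
  -- T u = α β e + T w, and ⟪e, T w⟫ = 0
  have hTu : T u = (α * β) • e + T w := by
    rw [hu_dec, map_add, map_smul, hTe, smul_smul]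
  have heTw : ⟪e, T w⟫ = 0 := by
    rw [← hsym, hTe, real_inner_smul_left, hew, mul_zero]
  have hTwe : ⟪T w, e⟫ = 0 := by rw [real_inner_comm]; exact heTw
  -- q = ‖w‖², p = α², p + q = 1
  set q : ℝ := ‖w‖ ^ 2 with hq
  have hq0 : 0 ≤ q := by positivity
  have hpq : α ^ 2 + q = 1 := by
    have h1 : ‖u‖ ^ 2 = ⟪u, u⟫ := (real_inner_self_eq_norm_sq u).symm
    rw [hu, one_pow, hu_dec, inner_add_left, inner_add_right, inner_add_right, real_inner_smul_left,
      real_inner_smul_left, real_inner_smul_right, real_inner_smul_right, hee, hew, hwe,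
      real_inner_self_eq_norm_sq] at h1
    rw [hq]; nlinarith [h1]
  -- η = α²β + ⟪T w, w⟫
  set η : ℝ := ⟪T u, u⟫ with hη
  set cw : ℝ := ⟪T w, w⟫ with hcw
  have hη_dec : η = α ^ 2 * β + cw := by
    rw [hη, hTu, hu_dec, inner_add_left, inner_add_right, inner_add_right, real_inner_smul_left,
      real_inner_smul_left, real_inner_smul_right, real_inner_smul_right, hee, hew, hTwe, hcw]
    ring
  -- ‖T u‖² = α²β² + ‖T w‖² ≥ α²β² + cw²/q  (Cauchy–Schwarz), i.e. q ‖T u‖² ≥ q α² β² + cw²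
  have hTu_sq : ‖T u‖ ^ 2 = α ^ 2 * β ^ 2 + ‖T w‖ ^ 2 := by
    have h1 : ‖T u‖ ^ 2 = ⟪T u, T u⟫ := (real_inner_self_eq_norm_sq _).symm
    rw [h1, hTu, inner_add_left, inner_add_right, inner_add_right, real_inner_smul_left,
      real_inner_smul_left, real_inner_smul_right, real_inner_smul_right, hee, heTw, hTwe,
      real_inner_self_eq_norm_sq]
    ring
  have hcs : cw ^ 2 ≤ ‖T w‖ ^ 2 * q := by
    rw [hcw, hq]
    have := abs_real_inner_le_norm (T w) w
    have h0 : 0 ≤ ‖T w‖ * ‖w‖ := by positivity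
    nlinarith [this, abs_nonneg ⟪T w, w⟫, sq_abs ⟪T w, w⟫]
  -- cw ≤ a q  (hypothesis on e^⊥)
  have hcw_le : cw ≤ a * q := by rw [hcw, hq]; exact h2 w hwe
  have hηa : 0 < η - a := sub_pos.2 ha
  -- α² > 0 (else η = cw ≤ a q ≤ ... contradiction with η > a): indeed if α = 0 then q = 1 and η = cw ≤ a
  have hp_pos : 0 < α ^ 2 := by
    by_contra hcon
    have hp0 : α ^ 2 = 0 := le_antisymm (not_lt.1 hcon) (sq_nonneg α)
    have hq1 : q = 1 := by linarith [hpq]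
    have : η ≤ a := by rw [hη_dec, hp0, zero_mul, zero_add]; simpa [hq1] using hcw_le
    linarith
  -- main inequality:  (β - η)(η - a) ≤ ‖T u‖² - η²
  have key : (β - η) * (η - a) ≤ ‖T u‖ ^ 2 - η ^ 2 := by
    -- from η = pβ + cw, ‖Tu‖² q ≥ q p β² + cw² (with p = α²) and cw ≤ a q:
    -- ‖Tu‖² - η² ≥ pβ² + cw²/q - (pβ + cw)²  = (p q β² ... ) handled via q-multiplication
    rcases eq_or_lt_of_le hq0 with hq00 | hqpos
    · -- q = 0: w = 0, u = ±e, η = β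
      have hq0' : q = 0 := hq00.symm
      have hp1 : α ^ 2 = 1 := by linarith [hpq]
      have hw0 : w = 0 := by
        have : ‖w‖ ^ 2 = 0 := by rw [← hq]; exact hq0'
        exact norm_eq_zero.1 (pow_eq_zero_iff (n := 2) (by norm_num) |>.1 this)
      have hcw0 : cw = 0 := by rw [hcw, hw0]; simp
      have hηβ : η = β := by rw [hη_dec, hp1, hcw0]; ring
      have hTw0 : ‖T w‖ = 0 := by rw [hw0, map_zero, norm_zero]
      rw [hηβ, sub_self, zero_mul, hTu_sq, hTw0, hp1]; ring_nf; exact le_refl _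
    · have h1 : q * (‖T u‖ ^ 2 - η ^ 2) ≥ q * ((β - η) * (η - a)) := by
        have hTw_sq : ‖T w‖ ^ 2 * q ≥ cw ^ 2 := hcs
        -- q‖Tu‖² = qα²β² + q‖Tw‖² ≥ qα²β² + cw²
        -- want: q(‖Tu‖² - η²) - q(β-η)(η-a) ≥ 0; substitute η = α²β + cw, α² = 1 - q
        have hp : α ^ 2 = 1 - q := by linarith [hpq]
        -- a < β (from η = pβ + cw ≤ pβ + aq and η > a = a(p+q), p > 0), hence cw ≤ aq ≤ βq
        have hβa : a < β := by
          have h4 : a * (α ^ 2 + q) < α ^ 2 * β + cw := by rw [hpq, mul_one, ← hη_dec]; exact ha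
          have h3 : a * α ^ 2 < β * α ^ 2 := by linarith [h4, hcw_le]
          exact lt_of_mul_lt_mul_right h3 hp_pos.le
        have hcwβ : cw ≤ β * q := le_trans hcw_le (by nlinarith [hβa, hq0])
        -- the identity  q(pβ² + N) − q(pβ+cw)² − q(qβ−cw)(pβ+cw−a) = (qN − cw²) + (cw − aq)(cw − qβ)  with p = 1 − q
        have hprod : 0 ≤ (cw - a * q) * (cw - β * q) :=
          mul_nonneg_of_nonpos_of_nonpos (sub_nonpos.2 hcw_le) (sub_nonpos.2 hcwβ)
        rw [hTu_sq, hη_dec, hp]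
        nlinarith [hTw_sq, hprod]
      exact le_of_mul_le_mul_left (by linarith [h1]) hqpos
  have : β - η ≤ (‖T u‖ ^ 2 - η ^ 2) / (η - a) := by
    rw [le_div_iff₀ hηa]; exact key
  linarith

/-- **Temple's quadratic-form bound.** Under the hypotheses of `eigenvalue_le_temple`, the whole form of `T` is
bounded: `⟪T f, f⟫ ≤ (η + (‖T u‖² − η²)/(η − a)) ‖f‖²` for every `f` (`η = ⟪T u, u⟫`). With `T` the compression
`𝖪[t]`, `e` its top eigenvector and `a ≥ λ₂(𝖪[t])`, this is the upper enclosure of `λ_max` used by the ET1e legs.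
[folklore: Temple 1928; Kato 1949] -/
theorem inner_le_temple_mul_norm_sq (T : E →ₗ[ℝ] E) (hsym : ∀ x y : E, ⟪T x, y⟫ = ⟪x, T y⟫)
    {β : ℝ} {e : E} (he : ‖e‖ = 1) (hTe : T e = β • e)
    {a : ℝ} (h2 : ∀ w : E, ⟪w, e⟫ = 0 → ⟪T w, w⟫ ≤ a * ‖w‖ ^ 2)
    {u : E} (hu : ‖u‖ = 1) (ha : a < ⟪T u, u⟫) (f : E) :
    ⟪T f, f⟫ ≤ (⟪T u, u⟫ + (‖T u‖ ^ 2 - ⟪T u, u⟫ ^ 2) / (⟪T u, u⟫ - a)) * ‖f‖ ^ 2 := by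
  set B : ℝ := ⟪T u, u⟫ + (‖T u‖ ^ 2 - ⟪T u, u⟫ ^ 2) / (⟪T u, u⟫ - a) with hB
  have hβB : β ≤ B := eigenvalue_le_temple T hsym he hTe h2 hu ha
  -- η ≤ B (Cauchy–Schwarz: η² ≤ ‖T u‖²) hence a ≤ B
  have hηB : ⟪T u, u⟫ ≤ B := by
    have hcs : ⟪T u, u⟫ ^ 2 ≤ ‖T u‖ ^ 2 := by
      have h1 := abs_real_inner_le_norm (T u) u
      rw [hu, mul_one] at h1
      nlinarith [h1, abs_nonneg ⟪T u, u⟫, sq_abs ⟪T u, u⟫]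
    have : 0 ≤ (‖T u‖ ^ 2 - ⟪T u, u⟫ ^ 2) / (⟪T u, u⟫ - a) :=
      div_nonneg (sub_nonneg.2 hcs) (sub_pos.2 ha).le
    linarith
  have haB : a ≤ B := le_trans ha.le hηB
  -- decomposition f = γ e + w
  set γ : ℝ := ⟪f, e⟫ with hγ
  set w : E := f - γ • e with hw
  have hee : ⟪e, e⟫ = 1 := by rw [real_inner_self_eq_norm_sq, he, one_pow]
  have hwe : ⟪w, e⟫ = 0 := by
    rw [hw, inner_sub_left, real_inner_smul_left, hee, mul_one, sub_self]
  have hew : ⟪e, w⟫ = 0 := by rw [real_inner_comm]; exact hwe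
  have hf_dec : f = γ • e + w := by rw [hw]; abel
  have hTwe : ⟪T w, e⟫ = 0 := by
    rw [hsym, hTe, real_inner_smul_right, hwe, mul_zero]
  have heTw : ⟪e, T w⟫ = 0 := by rw [real_inner_comm]; exact hTwe
  have hform : ⟪T f, f⟫ = γ ^ 2 * β + ⟪T w, w⟫ := by
    rw [hf_dec, map_add, map_smul, hTe, smul_smul, inner_add_left, inner_add_right, inner_add_right,
      real_inner_smul_left, real_inner_smul_left, real_inner_smul_right, real_inner_smul_right, hee, hew, hTwe]
    ring
  have hnorm : ‖f‖ ^ 2 = γ ^ 2 + ‖w‖ ^ 2 := by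
    have h1 : ‖f‖ ^ 2 = ⟪f, f⟫ := (real_inner_self_eq_norm_sq f).symm
    rw [h1, hf_dec, inner_add_left, inner_add_right, inner_add_right, real_inner_smul_left,
      real_inner_smul_left, real_inner_smul_right, real_inner_smul_right, hee, hew, hwe,
      real_inner_self_eq_norm_sq]
    ring
  have hw2 := h2 w hwe
  rw [hform, hnorm]
  have hγ2 : 0 ≤ γ ^ 2 := sq_nonneg γ
  have hw0 : 0 ≤ ‖w‖ ^ 2 := by positivity
  nlinarith [hβB, haB, hw2, hγ2, hw0]


/-- **The top of the quadratic form of a compact symmetric operator is attained** (when positive): if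
`⟪T x, x⟫ ≤ β` on unit vectors, the bound is approached (`∀ ε > 0 ∃` unit `x`, `β − ε < ⟪T x, x⟫`) and `β > 0`,
then `T e = β e` for some unit `e`.  (Maximising sequence; `‖(T − β)xₙ‖ → 0` via the positive shifted operator
`T + ‖T‖`; a convergent subsequence of `T xₙ` by compactness.)  Reed–Simon I Thm VI.16 for `T + ‖T‖·1`.
[folklore; cite: ReedSimonIV1978, Thm XIII.44] -/
theorem exists_eigenvector_of_rayleigh_sup [CompleteSpace E] (T : E →L[ℝ] E)
    (hsym : ∀ x y : E, ⟪T x, y⟫ = ⟪x, T y⟫) (hc : IsCompactOperator T) {β : ℝ} (hβ : 0 < β)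
    (hle : ∀ x : E, ‖x‖ = 1 → ⟪T x, x⟫ ≤ β) (happ : ∀ ε > 0, ∃ x : E, ‖x‖ = 1 ∧ β - ε < ⟪T x, x⟫) :
    ∃ e : E, ‖e‖ = 1 ∧ T e = β • e := by
  set c : ℝ := ‖T‖ with hc_def
  have hc0 : 0 ≤ c := norm_nonneg _
  -- the shifted positive operator
  set S : E →L[ℝ] E := T + c • ContinuousLinearMap.id ℝ E with hS
  have hS_apply : ∀ x : E, S x = T x + c • x := fun x => by simp [hS]
  have hsymS : ∀ x y : E, ⟪S x, y⟫ = ⟪x, S y⟫ := by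
    intro x y
    rw [hS_apply, hS_apply, inner_add_left, inner_add_right, real_inner_smul_left, real_inner_smul_right, hsym]
  have hTxx : ∀ x : E, |⟪T x, x⟫| ≤ c * ‖x‖ ^ 2 := by
    intro x
    calc |⟪T x, x⟫| ≤ ‖T x‖ * ‖x‖ := abs_real_inner_le_norm _ _
      _ ≤ c * ‖x‖ * ‖x‖ := by gcongr; exact T.le_opNorm x
      _ = c * ‖x‖ ^ 2 := by ring
  have hposS : ∀ x : E, 0 ≤ ⟪S x, x⟫ := by
    intro x
    rw [hS_apply, inner_add_left, real_inner_smul_left, real_inner_self_eq_norm_sq]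
    have := hTxx x
    have := neg_abs_le ⟪T x, x⟫
    linarith
  -- ‖S‖ = β + c
  have hSle : ‖S‖ ≤ β + c := by
    refine opNorm_le_of_rayleigh_le S hsymS hposS (by linarith) fun x hx => ?_
    rw [hS_apply, inner_add_left, real_inner_smul_left, real_inner_self_eq_norm_sq, hx, one_pow, mul_one]
    linarith [hle x hx]
  have hSge : β + c ≤ ‖S‖ := by
    refine le_of_forall_pos_lt_add fun ε hε => ?_
    obtain ⟨x, hx, hxε⟩ := happ ε hε
    have h1 : ⟪S x, x⟫ ≤ ‖S‖ := rayleigh_le_opNorm S hx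
    rw [hS_apply, inner_add_left, real_inner_smul_left, real_inner_self_eq_norm_sq, hx, one_pow, mul_one] at h1
    linarith
  have hSnorm : ‖S‖ = β + c := le_antisymm hSle hSge
  -- a maximising sequence
  choose x hx1 hxR using fun n : ℕ => happ (1 / ((n : ℝ) + 1)) (by positivity)
  have hRS : Tendsto (fun n => ⟪S (x n), x n⟫) atTop (𝓝 ‖S‖) := by
    have hform : ∀ n, ⟪S (x n), x n⟫ = ⟪T (x n), x n⟫ + c := fun n => by
      rw [hS_apply, inner_add_left, real_inner_smul_left, real_inner_self_eq_norm_sq, hx1 n, one_pow, mul_one]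
    rw [hSnorm]
    refine tendsto_of_tendsto_of_tendsto_of_le_of_le (g := fun n : ℕ => β + c - 1 / ((n : ℝ) + 1))
      (h := fun _ => β + c) ?_ tendsto_const_nhds (fun n => by rw [hform]; linarith [hxR n])
      (fun n => by rw [hform]; linarith [hle (x n) (hx1 n)])
    have := (tendsto_const_nhds (x := β + c)).sub (tendsto_one_div_add_atTop_nhds_zero_nat)
    simpa using this
  have hsub0 := tendsto_sub_smul_of_rayleigh S hx1 hRS
  have hsub : Tendsto (fun n => T (x n) - β • x n) atTop (𝓝 0) := by
    refine hsub0.congr fun n => ?_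
    rw [hS_apply, hSnorm, add_smul]; abel
  -- compactness: a convergent subsequence of `T xₙ`
  obtain ⟨K, hK, hTK⟩ := hc.image_closedBall_subset_compact (𝕜₁ := ℝ) 1
  have hmem : ∀ n, T (x n) ∈ K := fun n =>
    hTK ⟨x n, Metric.mem_closedBall.2 (by simp [hx1 n]), rfl⟩
  obtain ⟨y, -, φ, hφ, hy⟩ := hK.tendsto_subseq hmem
  have hx' : Tendsto (fun n => β • x (φ n)) atTop (𝓝 y) := by
    have h := hy.sub (hsub.comp hφ.tendsto_atTop)
    simp only [Function.comp_def, sub_zero] at h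
    refine h.congr fun n => ?_
    simp
  have hxe : Tendsto (fun n => x (φ n)) atTop (𝓝 (β⁻¹ • y)) := by
    have h := hx'.const_smul β⁻¹
    refine h.congr fun n => ?_
    rw [smul_smul, inv_mul_cancel₀ hβ.ne', one_smul]
  refine ⟨β⁻¹ • y, ?_, ?_⟩
  · have h := (continuous_norm.tendsto _).comp hxe
    have h1 : Tendsto (fun n => ‖x (φ n)‖) atTop (𝓝 1) := by simp [hx1]
    exact tendsto_nhds_unique h h1
  · have h1 : Tendsto (fun n => T (x (φ n))) atTop (𝓝 (T (β⁻¹ • y))) := (T.continuous.tendsto _).comp hxe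
    have h2 : Tendsto (fun n => T (x (φ n))) atTop (𝓝 y) := hy
    rw [tendsto_nhds_unique h1 h2, smul_smul, mul_inv_cancel₀ hβ.ne', one_smul]

/-- **Deflation from a codimension-one bound.** If `T e = β e` (`‖e‖ = 1`, `T` symmetric), the form of `T`
is `≤ a` on the kernel of a linear functional `L`, and `a < β`, then the form is `≤ a` on `e^⊥`
(test `g = L(w) e − L(e) w ∈ ker L`; `L e ≠ 0` since `⟪T e, e⟫ = β > a`). [folklore] -/
theorem inner_le_of_orthogonal_of_ker (T : E →ₗ[ℝ] E) (hsym : ∀ x y : E, ⟪T x, y⟫ = ⟪x, T y⟫)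
    {β : ℝ} {e : E} (he : ‖e‖ = 1) (hTe : T e = β • e) (L : E →ₗ[ℝ] ℝ) {a : ℝ}
    (hL : ∀ g : E, L g = 0 → ⟪T g, g⟫ ≤ a * ‖g‖ ^ 2) (haβ : a < β)
    (w : E) (hwe : ⟪w, e⟫ = 0) : ⟪T w, w⟫ ≤ a * ‖w‖ ^ 2 := by
  have hee : ⟪e, e⟫ = 1 := by rw [real_inner_self_eq_norm_sq, he, one_pow]
  have hew : ⟪e, w⟫ = 0 := by rw [real_inner_comm]; exact hwe
  have hTee : ⟪T e, e⟫ = β := by rw [hTe, real_inner_smul_left, hee, mul_one]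
  have hLe : L e ≠ 0 := by
    intro h0
    have := hL e h0
    rw [hTee, he, one_pow, mul_one] at this
    linarith
  have hTwe : ⟪T w, e⟫ = 0 := by rw [hsym, hTe, real_inner_smul_right, hwe, mul_zero]
  have heTw : ⟪e, T w⟫ = 0 := by rw [real_inner_comm]; exact hTwe
  set g : E := (L w) • e - (L e) • w with hg
  have hLg : L g = 0 := by simp [hg, mul_comm]
  have h1 := hL g hLg
  have hform : ⟪T g, g⟫ = (L w) ^ 2 * β + (L e) ^ 2 * ⟪T w, w⟫ := by
    rw [hg, map_sub, map_smul, map_smul, hTe, smul_smul]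
    simp only [inner_sub_left, inner_sub_right, real_inner_smul_left, real_inner_smul_right, hee, hew, hTwe]
    ring
  have hnorm : ‖g‖ ^ 2 = (L w) ^ 2 + (L e) ^ 2 * ‖w‖ ^ 2 := by
    have h2 : ‖g‖ ^ 2 = ⟪g, g⟫ := (real_inner_self_eq_norm_sq g).symm
    have hww : ⟪w, w⟫ = ‖w‖ ^ 2 := real_inner_self_eq_norm_sq w
    rw [h2, hg]
    simp only [inner_sub_left, inner_sub_right, real_inner_smul_left, real_inner_smul_right, hee, hew, hwe, hww]
    ring
  rw [hform, hnorm] at h1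
  have hLe2 : 0 < (L e) ^ 2 := by positivity
  -- (Le)² (⟪Tw,w⟫ − a‖w‖²) ≤ (Lw)² (a − β) ≤ 0
  have h3 : (L e) ^ 2 * (⟪T w, w⟫ - a * ‖w‖ ^ 2) ≤ (L w) ^ 2 * (a - β) := by nlinarith [h1]
  have h4 : (L w) ^ 2 * (a - β) ≤ 0 := mul_nonpos_of_nonneg_of_nonpos (sq_nonneg _) (by linarith)
  have h5 : ⟪T w, w⟫ - a * ‖w‖ ^ 2 ≤ 0 := by
    by_contra hcon
    have : 0 < (L e) ^ 2 * (⟪T w, w⟫ - a * ‖w‖ ^ 2) := mul_pos hLe2 (not_le.1 hcon)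
    linarith
  linarith

/-- **Temple's bound for a compact symmetric operator from a codimension-one certificate** (RH-free,
K-general; the logic of the ET1e sharp enclosures at the operator level): `T` compact symmetric on a real
Hilbert space, `L` a linear functional with `⟪T g, g⟫ ≤ a‖g‖²` on `ker L`, `u` a unit vector with
`η := ⟪T u, u⟫ > a` and `η > 0`. Then for every `f`,
`⟪T f, f⟫ ≤ (η + (‖T u‖² − η²)/(η − a)) ‖f‖²`.
Proof: the top of the form `β = sup ⟪T x, x⟫ ≥ η > 0` is attained at a unit eigenvector `e`
(`exists_eigenvector_of_rayleigh_sup`); the `ker L` bound deflates to `e^⊥` (`inner_le_of_orthogonal_of_ker`);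
Temple's algebra (`inner_le_temple_mul_norm_sq`). [folklore: Temple 1928, Kato 1949; cite: ReedSimonIV1978, Thm XIII.44] -/
theorem inner_le_temple_of_isCompactOperator [CompleteSpace E] (T : E →L[ℝ] E)
    (hsym : ∀ x y : E, ⟪T x, y⟫ = ⟪x, T y⟫) (hc : IsCompactOperator T)
    (L : E →ₗ[ℝ] ℝ) {a : ℝ} (hL : ∀ g : E, L g = 0 → ⟪T g, g⟫ ≤ a * ‖g‖ ^ 2)
    {u : E} (hu : ‖u‖ = 1) (ha : a < ⟪T u, u⟫) (hpos : 0 < ⟪T u, u⟫) (f : E) :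
    ⟪T f, f⟫ ≤ (⟪T u, u⟫ + (‖T u‖ ^ 2 - ⟪T u, u⟫ ^ 2) / (⟪T u, u⟫ - a)) * ‖f‖ ^ 2 := by
  -- the top of the form
  set R : Set ℝ := (fun x : E => ⟪T x, x⟫) '' {x : E | ‖x‖ = 1} with hR
  have hRbdd : BddAbove R := by
    refine ⟨‖T‖, ?_⟩
    rintro _ ⟨x, hx, rfl⟩
    exact rayleigh_le_opNorm T hx
  have huR : ⟪T u, u⟫ ∈ R := ⟨u, hu, rfl⟩
  have hRne : R.Nonempty := ⟨_, huR⟩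
  set β : ℝ := sSup R with hβ
  have hle : ∀ x : E, ‖x‖ = 1 → ⟪T x, x⟫ ≤ β := fun x hx => le_csSup hRbdd ⟨x, hx, rfl⟩
  have hηβ : ⟪T u, u⟫ ≤ β := hle u hu
  have hβ0 : 0 < β := lt_of_lt_of_le hpos hηβ
  have happ : ∀ ε > 0, ∃ x : E, ‖x‖ = 1 ∧ β - ε < ⟪T x, x⟫ := by
    intro ε hε
    obtain ⟨r, ⟨x, hx, rfl⟩, hr⟩ := exists_lt_of_lt_csSup hRne (by linarith : β - ε < β)
    exact ⟨x, hx, hr⟩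
  obtain ⟨e, he, hTe⟩ := exists_eigenvector_of_rayleigh_sup T hsym hc hβ0 hle happ
  have haβ : a < β := lt_of_lt_of_le ha hηβ
  -- pass to the underlying linear map
  have hsym' : ∀ x y : E, ⟪(T : E →ₗ[ℝ] E) x, y⟫ = ⟪x, (T : E →ₗ[ℝ] E) y⟫ := hsym
  have hTe' : (T : E →ₗ[ℝ] E) e = β • e := hTe
  have h2 : ∀ w : E, ⟪w, e⟫ = 0 → ⟪(T : E →ₗ[ℝ] E) w, w⟫ ≤ a * ‖w‖ ^ 2 :=
    inner_le_of_orthogonal_of_ker (T : E →ₗ[ℝ] E) hsym' he hTe' L hL haβ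
  exact inner_le_temple_mul_norm_sq (T : E →ₗ[ℝ] E) hsym' he hTe' h2 hu ha f

/-- **Certificate form** (the shape the engine's interval data plug into): with enclosures `η₁ ≤ ⟪T u, u⟫ ≤ η₂`,
`‖T u‖² − ⟪T u, u⟫² ≤ r₂` and `a < η₁`, `0 < η₁`, every `f` satisfies `⟪T f, f⟫ ≤ (η₂ + r₂/(η₁ − a)) ‖f‖²`.
In the ET1e legs `T = 𝖪_θ[t]`, `u` = top Ritz vector of the Galerkin matrix, `a = max(λ₂(M), 0) + rem`,
`r₂ = |Mu|² − η² + rem²` (json fields `temple.eta_plus`, `temple.a_plus`, `temple.r2_plus`). [folklore: Temple 1928] -/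
theorem inner_le_temple_certificate [CompleteSpace E] (T : E →L[ℝ] E)
    (hsym : ∀ x y : E, ⟪T x, y⟫ = ⟪x, T y⟫) (hc : IsCompactOperator T)
    (L : E →ₗ[ℝ] ℝ) {a : ℝ} (hL : ∀ g : E, L g = 0 → ⟪T g, g⟫ ≤ a * ‖g‖ ^ 2)
    {u : E} (hu : ‖u‖ = 1) {η₁ η₂ r₂ : ℝ} (hη₁ : η₁ ≤ ⟪T u, u⟫) (hη₂ : ⟪T u, u⟫ ≤ η₂)
    (hr₂ : ‖T u‖ ^ 2 - ⟪T u, u⟫ ^ 2 ≤ r₂) (ha : a < η₁) (hpos : 0 < η₁) (f : E) :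
    ⟪T f, f⟫ ≤ (η₂ + r₂ / (η₁ - a)) * ‖f‖ ^ 2 := by
  have ha' : a < ⟪T u, u⟫ := lt_of_lt_of_le ha hη₁
  have h := inner_le_temple_of_isCompactOperator T hsym hc L hL hu ha' (lt_of_lt_of_le hpos hη₁) f
  -- monotonicity of the bound in the data
  have hcs : 0 ≤ ‖T u‖ ^ 2 - ⟪T u, u⟫ ^ 2 := by
    have h1 := abs_real_inner_le_norm (T u) u
    rw [hu, mul_one] at h1
    nlinarith [h1, abs_nonneg ⟪T u, u⟫, sq_abs ⟪T u, u⟫]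
  have hd1 : 0 < ⟪T u, u⟫ - a := sub_pos.2 ha'
  have hd2 : 0 < η₁ - a := sub_pos.2 ha
  have hfrac : (‖T u‖ ^ 2 - ⟪T u, u⟫ ^ 2) / (⟪T u, u⟫ - a) ≤ r₂ / (η₁ - a) := by
    calc (‖T u‖ ^ 2 - ⟪T u, u⟫ ^ 2) / (⟪T u, u⟫ - a) ≤ (‖T u‖ ^ 2 - ⟪T u, u⟫ ^ 2) / (η₁ - a) :=
          div_le_div_of_nonneg_left hcs hd2 (by linarith)
      _ ≤ r₂ / (η₁ - a) := div_le_div_of_nonneg_right hr₂ hd2.le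
  have hf0 : 0 ≤ ‖f‖ ^ 2 := by positivity
  calc ⟪T f, f⟫ ≤ (⟪T u, u⟫ + (‖T u‖ ^ 2 - ⟪T u, u⟫ ^ 2) / (⟪T u, u⟫ - a)) * ‖f‖ ^ 2 := h
    _ ≤ (η₂ + r₂ / (η₁ - a)) * ‖f‖ ^ 2 := by
        apply mul_le_mul_of_nonneg_right _ hf0
        linarith

/-- **Temple certificate for Suzuki's window operator `𝖪[t]`** (the tree's `SuzukiWindowsDoorOpPath.op hK t` on
`L²(ℝ)`, kernel `1_{(−t,t)²}(x,y) K(x+y)`; self-adjoint and compact by `isSelfAdjoint_op` / `isCompactOperator_op`):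
a codimension-one form bound `⟪𝖪[t] g, g⟫ ≤ a‖g‖²` on `ker L` plus the Ritz data `(u, η₁, η₂, r₂)` with
`a < η₁`, `0 < η₁` bound the whole form: `⟪𝖪[t] f, f⟫ ≤ (η₂ + r₂/(η₁ − a)) ‖f‖²` for all `f ∈ L²(ℝ)`.
RH-FREE, K-general; the engine discharges the `ker L` premise from the Galerkin matrix (Weyl route, tree logic
p437286/p438128/p439269) — that bridge is NOT restated here. [folklore: Temple 1928; Kato 1949] -/
theorem inner_le_temple_certificate_op {K : ℝ → ℝ} (hK : Continuous K) (t : ℝ)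
    (L : MeasureTheory.Lp ℝ 2 (MeasureTheory.volume : MeasureTheory.Measure ℝ) →ₗ[ℝ] ℝ) {a : ℝ}
    (hL : ∀ g, L g = 0 → ⟪SuzukiWindowsDoorOpPath.op hK t g, g⟫ ≤ a * ‖g‖ ^ 2)
    {u : MeasureTheory.Lp ℝ 2 (MeasureTheory.volume : MeasureTheory.Measure ℝ)} (hu : ‖u‖ = 1)
    {η₁ η₂ r₂ : ℝ} (hη₁ : η₁ ≤ ⟪SuzukiWindowsDoorOpPath.op hK t u, u⟫)
    (hη₂ : ⟪SuzukiWindowsDoorOpPath.op hK t u, u⟫ ≤ η₂)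
    (hr₂ : ‖SuzukiWindowsDoorOpPath.op hK t u‖ ^ 2 - ⟪SuzukiWindowsDoorOpPath.op hK t u, u⟫ ^ 2 ≤ r₂)
    (ha : a < η₁) (hpos : 0 < η₁) (f : MeasureTheory.Lp ℝ 2 (MeasureTheory.volume : MeasureTheory.Measure ℝ)) :
    ⟪SuzukiWindowsDoorOpPath.op hK t f, f⟫ ≤ (η₂ + r₂ / (η₁ - a)) * ‖f‖ ^ 2 := by
  have hsa := SuzukiWindowsDoorOpPath.isSelfAdjoint_op hK t
  have hsym : ∀ x y, ⟪SuzukiWindowsDoorOpPath.op hK t x, y⟫ = ⟪x, SuzukiWindowsDoorOpPath.op hK t y⟫ :=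
    (ContinuousLinearMap.isSelfAdjoint_iff_isSymmetric.1 hsa)
  exact inner_le_temple_certificate _ hsym (SuzukiWindowsDoorOpPath.isCompactOperator_op hK t) L hL hu hη₁ hη₂ hr₂ ha hpos f

end Summit.RiemannHypothesis.RiemannHypothesis.Theorems.SuzukiWindowsDoorTemple
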